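import Mathlib.Analysis.Complex.Circle
import Literature.MathematicalPhysics.QuantumLattice.FockRelabel
import Literature.MathematicalPhysics.QuantumLattice.HubbardHalfFilledGroundStateRectTorus
import Literature.MathematicalPhysics.QuantumLattice.HubbardWave0LiebProofs
import Literature.MathematicalPhysics.QuantumLattice.HubbardRectangularTorus
import Literature.MathematicalPhysics.QuantumLattice.HubbardWave0RepulsiveProofs
import Literature.MathematicalPhysics.QuantumLattice.LTQOProofs
import HarnessLib

/-!
# The symmetry-projected variational bound `E₀(N) · ⟨Φ, P Φ⟩ ≤ Re ⟨Φ, H P Φ⟩`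

Topic `MathematicalPhysics/QuantumLattice`, family `hubbard`. The soundness statement behind
"symmetry-projected Hartree–Fock" (PHF, VAP) UPPER bounds on sector ground-state energies of
lattice fermion Hamiltonians: if `P` is an orthogonal projection (`Pᴴ = P = P²`) that commutes
with the Hamiltonian `H` and maps the trial vector `Φ` into the `N`-particle sector, then the
projected state `Ψ = P Φ` has norm `⟨Ψ, Ψ⟩ = ⟨Φ, P Φ⟩` and energy `⟨Ψ, H Ψ⟩ = ⟨Φ, H P Φ⟩`, so the
variational principle gives

  `E₀(N) · ⟨Φ, P Φ⟩ ≤ Re ⟨Φ, H P Φ⟩`, i.e. `E₀(N) ≤ ⟨Φ, H P Φ⟩ / ⟨Φ, P Φ⟩` whenever `P Φ ≠ 0`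

— the "projected energy" `E^Θ = ⟨Φ| Ĥ P^Θ |Φ⟩ / ⟨Φ| P^Θ |Φ⟩` of Rodríguez-Guzmán, Schmid,
Jiménez-Hoyos and Scuseria, Phys. Rev. B 85 (2012) 245130, §II eq. (8) (kernels
`ℋ^Θ = ⟨𝒟| Ĥ P^Θ |𝒟⟩`, `𝒩^Θ = ⟨𝒟| P^Θ |𝒟⟩`; read on arXiv:1204.2006 pp. 5–6), which is the
quantity a PHF code evaluates (ONE projector between bra and ket, not a sandwich `P H P`);
Shi, Jiménez-Hoyos, Rodríguez-Guzmán, Scuseria and Zhang, Phys. Rev. B 89 (2014) 125129, §II.A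
(same projectors as trial states for the 2D Hubbard model); the variational principle itself is
Tasaki (2020) §2.1 / the tree's `LiebThm1.groundEnergy_mul_norm_le`. The projection-operator
method goes back to Löwdin, Phys. Rev. 97 (1955) 1509.

Contents (everything PROVED; definitions have bodies; no named facts):

* §1 `expect_proj_mulVec`, `norm_proj_mulVec`, `groundEnergy_mul_re_expect_proj_le`,
  `groundEnergy_le_re_expect_proj_div` — the abstract statement on any fermionic Fock space
  `Fock ι`, for any operator `H` and any Hermitian idempotent `P` commuting with `H`;
* §2 `charProj ρ χ = |G|⁻¹ Σ_g conj χ(g) • U_g` — the CHARACTER PROJECTOR of a one-dimensional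
  unitary character `χ : G →* Circle` of a finite group `G` represented by unitaries
  `ρ : G →* U(n)` (Rodríguez-Guzmán et al. eq. (6), `Ĉ(ξ) = N⁻¹ Σ_j e^{-i k_ξ j} T̂_j`; Shi et al.
  eq. for `P̂^k_{mm'}` with `l = 1`): it is Hermitian, idempotent, commutes with every operator
  commuting with all `U_g`, and `⟨Φ, A P_χ Φ⟩ = |G|⁻¹ Σ_g conj χ(g) ⟨Φ, A U_g Φ⟩` (the kernel sum a
  PHF code computes); products of commuting Hermitian idempotents are Hermitian idempotents
  (private helpers, used for `P = Q · P_χ` in §3);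
* §3 the LATTICE binding: a finite group acting on the sites of a graph `G_Λ` by graph
  automorphisms (`π : G →* Equiv.Perm Λ`, `Adj (π g x) (π g y) ↔ Adj x y`) acts on the Fock space
  by the tree's orbital-permutation unitaries `latticeRep π g = fockRelabel (Orb.mapPerm (π g))`,
  which commute with the Hubbard Hamiltonian `hamiltonian G_Λ t U` (`relabel_hamiltonian`) and
  preserve every `N`-particle sector; hence **`groundEnergyAt_mul_re_expect_le_projected`**:
  for every `N`-particle `Φ`, every unitary character `χ`, and every further Hermitian idempotent
  `Q` commuting with `H`, with the `U_g`, and preserving the `N`-sector (the slot for a spin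
  projector),
  `groundEnergyAt G_Λ t U N · Re ⟨Φ, Q P_χ Φ⟩ ≤ Re ⟨Φ, H Q P_χ Φ⟩`
  (`…_div`: the quotient form when `Re ⟨Φ, Q P_χ Φ⟩ > 0`; `Q = 1`: pure space-group projection);
* §4 `autPerm G_Λ` (the graph automorphisms as a subgroup of the site permutations), the bound for
  any finite `S ≤ autPerm G_Λ` acting by inclusion (`…_of_le_autPerm`), and the square torus
  `(ℤ/Lℤ)²`: translations and `D₄` are automorphisms (tree lemmas), `squareSpaceGroup L` = the
  subgroup they generate, and **`rectTorus_groundEnergyAt_le_projected_div`** — the PHF bound for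
  `groundEnergyAt (fermionRectTorusGraph L L) t U N` with the full space group and any of its
  unitary characters (via `groundEnergyAt_fermionTorusGraph_two`);
* §5 `singletProj` — the singlet projector `P_{S=0}` DEFINED as the orthogonal projection onto
  `ker S²` (tree `projMatrix`): Hermitian, idempotent, range = singlets, commutes with the Hubbard
  Hamiltonian on any graph (`[S², H] = 0`, Lieb 1989), with every site-permutation
  unitary and with `N̂`; hence **`rectTorus_groundEnergyAt_le_singlet_projected_div`** — the bound
  with `Q = P_{S=0}` and all projector hypotheses discharged (RG2012 eq. (8) for `Θ = (S=0; k, parities)`).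
* §6 `singletProj_mulVec_halfFilled_groundState` — at half filling on an even rectangular torus with `t ≠ 0`,
  `U > 0` every ground-state eigenvector is a singlet (Lieb 1989, Theorem 2, tree
  `LiebHalfFilled.hubbardRectTorus_spinSq_mulVec_eq_zero_of_eigen`), hence FIXED by `P_{S=0}`: the `S = 0`
  projection of the PHF ansatz loses nothing there.

Honest scope. The SPIN projector used by PHF codes, `P^S_{ΣΣ'} = (2S+1)/(8π²) ∫ dΩ D^{S*}_{ΣΣ'}(Ω) R̂(Ω)`
(Rodríguez-Guzmán et al. eq. (5); for `S = 0` on `S^z = 0` determinants `½ ∫₀^π sin β e^{-iβ Ŝ_y} dβ`),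
is NOT constructed here: that this INTEGRAL is the orthogonal projection onto the singlet subspace is
`SU(2)` representation theory (orthogonality of Wigner functions) which the tree does not have;
§3 takes an abstract slot `Q` (any Hermitian idempotent commuting with `H`, `N̂` and the lattice
unitaries) and §5 instantiates `Q` with the spectrally DEFINED singlet projector `singletProj`
(orthogonal projection onto `ker S²`), so that only the identification "β-integral = `singletProj`
on `S^z = 0` vectors" remains outside the kernel. Likewise the exact evaluation of the kernels `⟨Φ, H U_g R(β) Φ'⟩`
for Slater determinants `Φ, Φ'` (Löwdin's formulas) is not formalised; a certificate that quotes
this file certifies the INEQUALITY SHAPE and the projector algebra, and supplies the kernel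
arithmetic by two independent exact implementations.
-/

noncomputable section

namespace Literature.MathematicalPhysics.QuantumLattice

open Matrix Finset HubbardWave0
open scoped ComplexConjugate ComplexOrder

namespace SymmetryProjection

/-! ### §1. The projected variational principle (abstract) -/

section Abstract

variable {ι : Type*} [LinearOrder ι] [Fintype ι]

omit [LinearOrder ι] in
/-- `⟨B φ, A B φ⟩ = ⟨φ, Bᴴ A B φ⟩`. [folklore] -/
private theorem expect_mulVec (A B : Matrix (Finset ι) (Finset ι) ℂ) (φ : Fock ι) :
    expect A (B *ᵥ φ) = expect (Bᴴ * A * B) φ := by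
  unfold expect
  rw [star_mulVec, ← dotProduct_mulVec, mulVec_mulVec, mulVec_mulVec]

omit [LinearOrder ι] in
/-- **`⟨P φ, A P φ⟩ = ⟨φ, A P φ⟩`** for a Hermitian idempotent `P` commuting with `A`: the energy of
the projected state is the "projected energy kernel" with ONE projector.
[cite: RodriguezGuzmanEtAl2012, §II eq. (8)] -/
theorem expect_proj_mulVec {P A : Matrix (Finset ι) (Finset ι) ℂ} (hP : Pᴴ = P) (hPP : P * P = P)
    (hPA : Commute P A) (φ : Fock ι) : expect A (P *ᵥ φ) = expect (A * P) φ := by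
  rw [expect_mulVec, hP, hPA.eq, Matrix.mul_assoc, hPP]

/-- **`‖P φ‖² = ⟨φ, P φ⟩`** for a Hermitian idempotent `P` (the "norm kernel").
[cite: RodriguezGuzmanEtAl2012, §II eq. (8)] -/
theorem norm_proj_mulVec {P : Matrix (Finset ι) (Finset ι) ℂ} (hP : Pᴴ = P) (hPP : P * P = P)
    (φ : Fock ι) : star (P *ᵥ φ) ⬝ᵥ (P *ᵥ φ) = expect P φ := by
  have h := expect_proj_mulVec hP hPP (Commute.one_right P) φ
  rw [Matrix.one_mul] at h
  rw [← h, expect, one_mulVec]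

/-- The norm kernel `𝒩 = ⟨Φ, P Φ⟩ = ‖P Φ‖²` is real and nonnegative. [cite: RodriguezGuzmanEtAl2012, §II eq. (8)] -/
theorem re_expect_proj_nonneg {P : Matrix (Finset ι) (Finset ι) ℂ} (hP : Pᴴ = P) (hPP : P * P = P)
    (φ : Fock ι) : 0 ≤ (expect P φ).re := by
  rw [← norm_proj_mulVec hP hPP φ]
  exact (Complex.nonneg_iff.1 (dotProduct_star_self_nonneg _)).1

/-- The norm kernel `𝒩 = ⟨Φ, P Φ⟩` vanishes exactly when the projected state `P Φ` does.
[cite: RodriguezGuzmanEtAl2012, §II eq. (8)] -/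
theorem expect_proj_eq_zero_iff {P : Matrix (Finset ι) (Finset ι) ℂ} (hP : Pᴴ = P) (hPP : P * P = P)
    (φ : Fock ι) : expect P φ = 0 ↔ P *ᵥ φ = 0 := by
  rw [← norm_proj_mulVec hP hPP φ, dotProduct_star_self_eq_zero]

/-- **The projected variational principle** (homogeneous form, no non-vanishing hypothesis):
for any operator `H`, any Hermitian idempotent `P` commuting with `H`, and any `φ` whose
projection `P φ` lies in the `N`-particle sector,
`E₀(N) · ⟨φ, P φ⟩ ≤ Re ⟨φ, H P φ⟩`. (`LiebThm1.groundEnergy_mul_norm_le` for `ψ = P φ`.)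
[cite: RodriguezGuzmanEtAl2012, §II eq. (8)] [cite: Tasaki2020, §2.1] -/
theorem groundEnergy_mul_re_expect_proj_le (H : Matrix (Finset ι) (Finset ι) ℂ)
    {P : Matrix (Finset ι) (Finset ι) ℂ} (hP : Pᴴ = P) (hPP : P * P = P) (hPH : Commute P H)
    {N : ℕ} {φ : Fock ι} (hPφ : IsNParticle N (P *ᵥ φ)) :
    groundEnergy H N * (expect P φ).re ≤ (expect (H * P) φ).re := by
  have h := LiebThm1.groundEnergy_mul_norm_le H hPφ
  rwa [norm_proj_mulVec hP hPP, expect_proj_mulVec hP hPP hPH] at h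

/-- **The projected variational principle**, quotient form: if moreover `⟨φ, P φ⟩ > 0` then
`E₀(N) ≤ Re ⟨φ, H P φ⟩ / ⟨φ, P φ⟩` — the PHF "projected energy" is an upper bound on the sector
ground-state energy. [cite: RodriguezGuzmanEtAl2012, §II eq. (8)] [cite: Tasaki2020, §2.1] -/
theorem groundEnergy_le_re_expect_proj_div (H : Matrix (Finset ι) (Finset ι) ℂ)
    {P : Matrix (Finset ι) (Finset ι) ℂ} (hP : Pᴴ = P) (hPP : P * P = P) (hPH : Commute P H)
    {N : ℕ} {φ : Fock ι} (hPφ : IsNParticle N (P *ᵥ φ)) (hpos : 0 < (expect P φ).re) :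
    groundEnergy H N ≤ (expect (H * P) φ).re / (expect P φ).re :=
  (le_div_iff₀ hpos).2 (groundEnergy_mul_re_expect_proj_le H hP hPP hPH hPφ)

omit [LinearOrder ι] in
/-- Products of two commuting Hermitian idempotents are Hermitian. [folklore] -/
private theorem proj_mul_conjTranspose {P Q : Matrix (Finset ι) (Finset ι) ℂ} (hP : Pᴴ = P) (hQ : Qᴴ = Q)
    (hPQ : Commute P Q) : (P * Q)ᴴ = P * Q := by
  rw [conjTranspose_mul, hP, hQ, hPQ.eq]

omit [LinearOrder ι] in
/-- Products of two commuting idempotents are idempotent. [folklore] -/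
private theorem proj_mul_mul_self {P Q : Matrix (Finset ι) (Finset ι) ℂ} (hPP : P * P = P) (hQQ : Q * Q = Q)
    (hPQ : Commute P Q) : P * Q * (P * Q) = P * Q := by
  rw [Matrix.mul_assoc, ← Matrix.mul_assoc Q P Q, ← hPQ.eq, Matrix.mul_assoc, hQQ, ← Matrix.mul_assoc, hPP]

end Abstract

/-! ### §2. Character projectors of a finite symmetry group -/

section CharProj

variable {n : Type*} [Fintype n] [DecidableEq n] {G : Type*} [Group G] [Fintype G]

/-- **The character projector** `P_χ = |G|⁻¹ Σ_g conj χ(g) • U_g` of a one-dimensional unitary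
character `χ` of a finite group `G` acting by unitaries `U_g = ρ g` — the space-group /
linear-momentum projector of PHF (`Ĉ(ξ) = N_sites⁻¹ Σ_j e^{-i k_ξ·j} T̂_j`; `P̂^k = h⁻¹ Σ_g Γ^{k*}(g) R̂(g)`
for a one-dimensional irrep). [cite: RodriguezGuzmanEtAl2012, §II eq. (6)] [cite: ShiEtAl2014, §II.A] -/
def charProj (ρ : G →* Matrix.unitaryGroup n ℂ) (χ : G →* Circle) : Matrix n n ℂ :=
  (Fintype.card G : ℂ)⁻¹ • ∑ g : G, conj ((χ g : Circle) : ℂ) • (ρ g).val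

variable (ρ : G →* Matrix.unitaryGroup n ℂ) (χ : G →* Circle)

omit [Fintype G] in
/-- `U_{g⁻¹} = U_gᴴ` for a unitary representation. [folklore] -/
private theorem val_map_inv (g : G) : (ρ g⁻¹).val = (ρ g).valᴴ := by
  rw [map_inv, Matrix.UnitaryGroup.inv_val, star_eq_conjTranspose]

omit [Fintype G] in
/-- `conj χ(g) = χ(g⁻¹)` for a unitary character. [folklore] -/
private theorem conj_coe_char (g : G) : conj ((χ g : Circle) : ℂ) = ((χ g⁻¹ : Circle) : ℂ) := by
  rw [map_inv, Circle.coe_inv_eq_conj]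

/-- The character projector is Hermitian. [cite: RodriguezGuzmanEtAl2012, §II eq. (6)] -/
theorem charProj_conjTranspose : (charProj ρ χ)ᴴ = charProj ρ χ := by
  unfold charProj
  rw [conjTranspose_smul, conjTranspose_sum]
  have h1 : star ((Fintype.card G : ℂ)⁻¹) = (Fintype.card G : ℂ)⁻¹ := by simp
  rw [h1]
  congr 1
  refine Fintype.sum_equiv (Equiv.inv G) _ _ fun x => ?_
  rw [Equiv.inv_apply, conjTranspose_smul, Complex.star_def, Complex.conj_conj, val_map_inv,
    conj_coe_char, inv_inv]

/-- The character projector is idempotent (`P_χ² = P_χ`: reindex the double sum by `h ↦ g⁻¹ k`).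
[cite: RodriguezGuzmanEtAl2012, §II eq. (6)] -/
theorem charProj_mul_self : charProj ρ χ * charProj ρ χ = charProj ρ χ := by
  have hc : (Fintype.card G : ℂ) ≠ 0 := Nat.cast_ne_zero.2 Fintype.card_ne_zero
  have hterm : ∀ g h : G,
      (conj ((χ g : Circle) : ℂ) • (ρ g).val) * (conj ((χ h : Circle) : ℂ) • (ρ h).val) =
        conj ((χ (g * h) : Circle) : ℂ) • (ρ (g * h)).val := by
    intro g h
    rw [smul_mul_assoc, mul_smul_comm, smul_smul, map_mul χ, Circle.coe_mul, map_mul (starRingEnd ℂ),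
      map_mul ρ, Matrix.UnitaryGroup.mul_val]
  have hre : ∀ g : G, ∑ h : G, conj ((χ (g * h) : Circle) : ℂ) • (ρ (g * h)).val =
      ∑ k : G, conj ((χ k : Circle) : ℂ) • (ρ k).val :=
    fun g => Fintype.sum_equiv (Equiv.mulLeft g) _ _ fun h => rfl
  unfold charProj
  rw [smul_mul_assoc, mul_smul_comm, smul_smul, Finset.sum_mul_sum]
  simp_rw [hterm, hre]
  rw [Finset.sum_const, Finset.card_univ, ← Nat.cast_smul_eq_nsmul ℂ, smul_smul]
  congr 1
  rw [mul_assoc, inv_mul_cancel₀ hc, mul_one]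

/-- The character projector commutes with every operator commuting with all the `U_g` — in
particular with a Hamiltonian whose symmetry operations the `U_g` are.
[cite: RodriguezGuzmanEtAl2012, §II eq. (6)] -/
theorem charProj_commute {A : Matrix n n ℂ} (h : ∀ g, Commute (ρ g).val A) : Commute (charProj ρ χ) A := by
  unfold charProj
  exact (Commute.sum_left _ _ _ fun g _ => (h g).smul_left _).smul_left _

end CharProj

section CharProjFock

variable {ι : Type*} [LinearOrder ι] [Fintype ι] {G : Type*} [Group G] [Fintype G]
  (ρ : G →* Matrix.unitaryGroup (Finset ι) ℂ) (χ : G →* Circle)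

/-- **The kernel sum.** `⟨φ, A P_χ φ⟩ = |G|⁻¹ Σ_g conj χ(g) ⟨φ, A U_g φ⟩`: the projected energy /
norm kernels are finite sums of "rotated" matrix elements — the quantity a PHF implementation
evaluates. [cite: RodriguezGuzmanEtAl2012, §II eqs. (6), (8)] -/
theorem expect_mul_charProj (A : Matrix (Finset ι) (Finset ι) ℂ) (φ : Fock ι) :
    expect (A * charProj ρ χ) φ =
      (Fintype.card G : ℂ)⁻¹ * ∑ g : G, conj ((χ g : Circle) : ℂ) * expect (A * (ρ g).val) φ := by
  simp only [charProj, expect, Matrix.mul_smul, Finset.mul_sum, smul_mulVec, sum_mulVec, dotProduct_smul,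
    dotProduct_sum, smul_eq_mul]

/-- `P_χ` maps the `N`-particle sector to itself when every `U_g` does. [folklore] -/
private theorem isNParticle_charProj_mulVec {N : ℕ} (hρ : ∀ (g : G) (ψ : Fock ι), IsNParticle N ψ → IsNParticle N ((ρ g).val *ᵥ ψ))
    {φ : Fock ι} (hφ : IsNParticle N φ) : IsNParticle N (charProj ρ χ *ᵥ φ) := by
  rw [← mem_nParticleSubmodule_iff]
  unfold charProj
  rw [smul_mulVec, sum_mulVec]
  refine Submodule.smul_mem _ _ (Submodule.sum_mem _ fun g _ => ?_)
  rw [smul_mulVec]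
  exact Submodule.smul_mem _ _ ((mem_nParticleSubmodule_iff _ _).2 (hρ g φ hφ))

end CharProjFock

/-! ### §3. Lattice symmetries of a Hubbard Hamiltonian and the projected bound -/

section Lattice

variable {Λ : Type*} [LinearOrder Λ] [Fintype Λ] (GΛ : SimpleGraph Λ) [DecidableRel GΛ.Adj]
  {G : Type*} [Group G] [Fintype G]

/-- A finite group acting on the sites by `π : G →* S_Λ` acts on the fermionic Fock space by the
orbital-permutation unitaries `U_g = fockRelabel (Orb.mapPerm (π g))` (`(x, σ) ↦ (π g x, σ)`,
second-quantised with the Jordan–Wigner sign) — the space-group operators `R̂(g)` / `T̂_j` of PHF.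
[cite: ShiEtAl2014, §II.A] [cite: BratteliRobinsonII1997, §5.2.2, Thm. 5.2.5] -/
def latticeRep (π : G →* Equiv.Perm Λ) : G →* Matrix.unitaryGroup (Finset (Orb Λ)) ℂ :=
  fockRelabel.comp (Orb.mapPerm.comp π)

omit [Fintype G] in
/-- `latticeRep π g = U_{π g}`. [folklore] -/
@[simp] private theorem latticeRep_apply (π : G →* Equiv.Perm Λ) (g : G) :
    latticeRep π g = fockRelabel (Orb.mapPerm (π g)) := rfl

omit [Fintype G] in
/-- **Graph automorphisms are symmetries of the Hubbard Hamiltonian**: if every `π g` preserves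
adjacency then `U_g` commutes with `hamiltonian G_Λ t U` (`relabel_hamiltonian`): the `U_g` are
symmetry operations of the lattice Hamiltonian. [cite: ShiEtAl2014, §II.A] -/
theorem latticeRep_commute_hamiltonian (π : G →* Equiv.Perm Λ)
    (hπ : ∀ g x y, GΛ.Adj (π g x) (π g y) ↔ GΛ.Adj x y) (t U : ℝ) (g : G) :
    Commute (latticeRep π g).val (hamiltonian GΛ t U) := by
  rw [latticeRep_apply, Orb.mapPerm_apply]
  exact fockRelabel_commute_of_relabel_eq _ (relabel_hamiltonian GΛ GΛ (π g) (hπ g) t U)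

omit [Fintype G] in
/-- The lattice unitaries conserve the particle number (one-particle unitaries are implemented
by number-conserving Bogoliubov transformations). [cite: BratteliRobinsonII1997, §5.2.2, Thm. 5.2.5] -/
theorem latticeRep_commute_totalNumber (π : G →* Equiv.Perm Λ) (g : G) :
    Commute (latticeRep π g).val (totalNumber : Matrix (Finset (Orb Λ)) _ ℂ) :=
  fockRelabel_mapEquiv_commute_totalNumber (π g)

omit [Fintype G] in
/-- The lattice unitaries preserve every `N`-particle sector. [cite: BratteliRobinsonII1997, §5.2.2, Thm. 5.2.5] -/
theorem isNParticle_latticeRep_mulVec (π : G →* Equiv.Perm Λ) (g : G) {N : ℕ} {ψ : Fock (Orb Λ)}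
    (hψ : IsNParticle N ψ) : IsNParticle N ((latticeRep π g).val *ᵥ ψ) :=
  hψ.fockRelabel_mulVec _

/-- **The symmetry-projected variational bound for a Hubbard Hamiltonian** (homogeneous form).
For a finite group of graph automorphisms (`π`, `hπ`), a one-dimensional unitary character `χ`,
a further Hermitian idempotent `Q` commuting with `H`, with the lattice unitaries, and preserving
the `N`-particle sector (the slot for a spin projector; `Q = 1` allowed), and ANY `N`-particle
vector `Φ` (e.g. a Slater determinant with `N↑ + N↓ = N`):
`E₀(G_Λ, t, U; N) · Re ⟨Φ, Q P_χ Φ⟩ ≤ Re ⟨Φ, H Q P_χ Φ⟩`, where `P_χ = |G|⁻¹ Σ_g conj χ(g) U_g`.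
[cite: RodriguezGuzmanEtAl2012, §II eqs. (5)–(8)] [cite: ShiEtAl2014, §II.A] [cite: Tasaki2020, §2.1] -/
theorem groundEnergyAt_mul_re_expect_le_projected (π : G →* Equiv.Perm Λ)
    (hπ : ∀ g x y, GΛ.Adj (π g x) (π g y) ↔ GΛ.Adj x y) (t U : ℝ) (χ : G →* Circle)
    {Q : Matrix (Finset (Orb Λ)) (Finset (Orb Λ)) ℂ} (hQ : Qᴴ = Q) (hQQ : Q * Q = Q)
    (hQH : Commute Q (hamiltonian GΛ t U)) (hQρ : ∀ g, Commute (latticeRep π g).val Q)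
    {N : ℕ} (hQN : ∀ ψ : Fock (Orb Λ), IsNParticle N ψ → IsNParticle N (Q *ᵥ ψ))
    {φ : Fock (Orb Λ)} (hφ : IsNParticle N φ) :
    groundEnergyAt GΛ t U N * (expect (Q * charProj (latticeRep π) χ) φ).re ≤
      (expect (hamiltonian GΛ t U * (Q * charProj (latticeRep π) χ)) φ).re := by
  have hcomm : Commute Q (charProj (latticeRep π) χ) := (charProj_commute _ _ hQρ).symm
  have hP : (Q * charProj (latticeRep π) χ)ᴴ = Q * charProj (latticeRep π) χ :=
    proj_mul_conjTranspose hQ (charProj_conjTranspose _ _) hcomm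
  have hPP := proj_mul_mul_self hQQ (charProj_mul_self (latticeRep π) χ) hcomm
  have hPH : Commute (Q * charProj (latticeRep π) χ) (hamiltonian GΛ t U) :=
    hQH.mul_left (charProj_commute _ _ fun g => latticeRep_commute_hamiltonian GΛ π hπ t U g)
  have hPφ : IsNParticle N ((Q * charProj (latticeRep π) χ) *ᵥ φ) := by
    rw [← mulVec_mulVec]
    exact hQN _ (isNParticle_charProj_mulVec _ _
      (fun g ψ hψ => isNParticle_latticeRep_mulVec π g hψ) hφ)
  exact groundEnergy_mul_re_expect_proj_le _ hP hPP hPH hPφ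

/-- **The symmetry-projected variational bound**, quotient form: when the norm kernel
`Re ⟨Φ, Q P_χ Φ⟩` is positive, the PHF projected energy `Re ⟨Φ, H Q P_χ Φ⟩ / Re ⟨Φ, Q P_χ Φ⟩` is an
UPPER bound on `groundEnergyAt G_Λ t U N`.
[cite: RodriguezGuzmanEtAl2012, §II eq. (8)] [cite: ShiEtAl2014, §II.A] [cite: Tasaki2020, §2.1] -/
theorem groundEnergyAt_le_projected_div (π : G →* Equiv.Perm Λ)
    (hπ : ∀ g x y, GΛ.Adj (π g x) (π g y) ↔ GΛ.Adj x y) (t U : ℝ) (χ : G →* Circle)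
    {Q : Matrix (Finset (Orb Λ)) (Finset (Orb Λ)) ℂ} (hQ : Qᴴ = Q) (hQQ : Q * Q = Q)
    (hQH : Commute Q (hamiltonian GΛ t U)) (hQρ : ∀ g, Commute (latticeRep π g).val Q)
    {N : ℕ} (hQN : ∀ ψ : Fock (Orb Λ), IsNParticle N ψ → IsNParticle N (Q *ᵥ ψ))
    {φ : Fock (Orb Λ)} (hφ : IsNParticle N φ)
    (hpos : 0 < (expect (Q * charProj (latticeRep π) χ) φ).re) :
    groundEnergyAt GΛ t U N ≤
      (expect (hamiltonian GΛ t U * (Q * charProj (latticeRep π) χ)) φ).re /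
        (expect (Q * charProj (latticeRep π) χ) φ).re :=
  (le_div_iff₀ hpos).2 (groundEnergyAt_mul_re_expect_le_projected GΛ π hπ t U χ hQ hQQ hQH hQρ hQN hφ)

/-- **Pure space-group projection** (`Q = 1`): for every `N`-particle `Φ`,
`E₀(N) · Re ⟨Φ, P_χ Φ⟩ ≤ Re ⟨Φ, H P_χ Φ⟩`. [cite: RodriguezGuzmanEtAl2012, §II eqs. (6), (8)] -/
theorem groundEnergyAt_mul_re_expect_charProj_le (π : G →* Equiv.Perm Λ)
    (hπ : ∀ g x y, GΛ.Adj (π g x) (π g y) ↔ GΛ.Adj x y) (t U : ℝ) (χ : G →* Circle)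
    {N : ℕ} {φ : Fock (Orb Λ)} (hφ : IsNParticle N φ) :
    groundEnergyAt GΛ t U N * (expect (charProj (latticeRep π) χ) φ).re ≤
      (expect (hamiltonian GΛ t U * charProj (latticeRep π) χ) φ).re := by
  have h := groundEnergyAt_mul_re_expect_le_projected GΛ π hπ t U χ (Q := 1) conjTranspose_one
    (Matrix.one_mul 1) (Commute.one_left _) (fun g => Commute.one_right _) (fun ψ hψ => by rwa [one_mulVec]) hφ
  simpa only [Matrix.one_mul] using h

/-- The kernels of the lattice bound as finite sums over the group:
`⟨Φ, H Q P_χ Φ⟩ = |G|⁻¹ Σ_g conj χ(g) ⟨Φ, (H Q) U_g Φ⟩` (and the norm kernel with `H Q ↦ Q`).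
[cite: RodriguezGuzmanEtAl2012, §II eqs. (6), (8)] -/
theorem expect_mul_mul_charProj (π : G →* Equiv.Perm Λ) (χ : G →* Circle)
    (A Q : Matrix (Finset (Orb Λ)) (Finset (Orb Λ)) ℂ) (φ : Fock (Orb Λ)) :
    expect (A * (Q * charProj (latticeRep π) χ)) φ =
      (Fintype.card G : ℂ)⁻¹ * ∑ g : G, conj ((χ g : Circle) : ℂ) * expect (A * Q * (latticeRep π g).val) φ := by
  rw [← Matrix.mul_assoc]
  exact expect_mul_charProj _ _ _ _

end Lattice

/-! ### §4. The automorphism group of the hopping graph; the square torus `(ℤ/Lℤ)²` -/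

section Aut

variable {Λ : Type*} [LinearOrder Λ] [Fintype Λ] (GΛ : SimpleGraph Λ) [DecidableRel GΛ.Adj]
  {G : Type*} [Group G] [Fintype G]

omit [LinearOrder Λ] [Fintype Λ] [DecidableRel GΛ.Adj] in
/-- **The automorphism group of the hopping graph** as a subgroup of the site permutations:
`f ∈ autPerm G_Λ ↔ ∀ x y, Adj (f x) (f y) ↔ Adj x y` — the "symmetry operations in the
considered lattices" of PHF. [cite: ShiEtAl2014, §II.A] -/
def autPerm : Subgroup (Equiv.Perm Λ) where
  carrier := {f | ∀ x y, GΛ.Adj (f x) (f y) ↔ GΛ.Adj x y}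
  mul_mem' {f g} hf hg x y := by rw [Equiv.Perm.mul_apply, Equiv.Perm.mul_apply, hf, hg]
  one_mem' _ _ := Iff.rfl
  inv_mem' {f} hf x y := by
    have h := hf (f.symm x) (f.symm y)
    rw [Equiv.apply_symm_apply, Equiv.apply_symm_apply] at h
    rw [Equiv.Perm.coe_inv]
    exact h.symm

omit [LinearOrder Λ] [Fintype Λ] [DecidableRel GΛ.Adj] in
/-- Membership in `autPerm`. [folklore] -/
private theorem mem_autPerm_iff (f : Equiv.Perm Λ) :
    f ∈ autPerm GΛ ↔ ∀ x y, GΛ.Adj (f x) (f y) ↔ GΛ.Adj x y := Iff.rfl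

/-- **The symmetry-projected bound for any finite group of lattice automorphisms** `S ≤ autPerm G_Λ`
(acting through the inclusion `S →* S_Λ`) and any unitary character `χ` of `S`: the quotient form
`E₀(G_Λ,t,U;N) ≤ Re ⟨Φ, H Q P_χ Φ⟩ / Re ⟨Φ, Q P_χ Φ⟩`. This is the form a certificate instantiates
(`S` = the subgroup generated by the translations and point-group operations it sums over, each
generator checked to preserve adjacency; `|S|` and `χ` as tabulated).
[cite: RodriguezGuzmanEtAl2012, §II eqs. (6), (8)] [cite: ShiEtAl2014, §II.A] -/
theorem groundEnergyAt_le_projected_div_of_le_autPerm {S : Subgroup (Equiv.Perm Λ)} [Fintype S]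
    (hS : S ≤ autPerm GΛ) (t U : ℝ) (χ : S →* Circle)
    {Q : Matrix (Finset (Orb Λ)) (Finset (Orb Λ)) ℂ} (hQ : Qᴴ = Q) (hQQ : Q * Q = Q)
    (hQH : Commute Q (hamiltonian GΛ t U)) (hQρ : ∀ g : S, Commute (latticeRep S.subtype g).val Q)
    {N : ℕ} (hQN : ∀ ψ : Fock (Orb Λ), IsNParticle N ψ → IsNParticle N (Q *ᵥ ψ))
    {φ : Fock (Orb Λ)} (hφ : IsNParticle N φ)
    (hpos : 0 < (expect (Q * charProj (latticeRep S.subtype) χ) φ).re) :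
    groundEnergyAt GΛ t U N ≤
      (expect (hamiltonian GΛ t U * (Q * charProj (latticeRep S.subtype) χ)) φ).re /
        (expect (Q * charProj (latticeRep S.subtype) χ) φ).re :=
  groundEnergyAt_le_projected_div GΛ S.subtype (fun g x y => (mem_autPerm_iff GΛ g.1).1 (hS g.2) x y)
    t U χ hQ hQQ hQH hQρ hQN hφ hpos

end Aut

section SquareTorus

open Literature.Probability.LatticeModels

variable {L : ℕ} [NeZero L]

/-- (Local to this section, as in `HubbardSectorCorrelatorCertificate` / `MagneticHubbardTorusUniformDensity`:
pins `DecidableEq (FermionTorus 2 L)` to the `LinearOrder` one so that the `Finset (Orb _)` matrix types of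
this file and of `hubbardTorus` agree syntactically.) [folklore] -/
local instance (priority := high) instDecidableEqFermionTorusSymmetryProjection :
    DecidableEq (FermionTorus 2 L) :=
  LinearOrder.toDecidableEq

/-- Translations `x ↦ x + v` of `(ℤ/Lℤ)²` are automorphisms of the nearest-neighbour torus graph
(tree `fermionTorusGraph_adj_addRight`). [cite: RodriguezGuzmanEtAl2012, §II eq. (6)] -/
theorem ofTorusPerm_addRight_mem_autPerm (v : TorusSite 2 L) :
    FermionTorus.ofTorusPerm (Equiv.addRight v) ∈ autPerm (fermionTorusGraph 2 L) :=
  fun x y => fermionTorusGraph_adj_addRight v x y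

/-- The point group `D₄` (rotations/reflections about a site) acts by automorphisms of the torus
graph (tree `fermionTorusGraph_adj_d4SitePerm`). [cite: ShiEtAl2014, §II.A] -/
theorem ofTorusPerm_d4SitePerm_mem_autPerm (γ : DihedralGroup 4) :
    FermionTorus.ofTorusPerm (d4SitePerm γ) ∈ autPerm (fermionTorusGraph 2 L) :=
  fun x y => fermionTorusGraph_adj_d4SitePerm γ x y

variable (L) in
/-- **The space group of the square torus used by PHF**: the subgroup of site permutations of
`(ℤ/Lℤ)²` generated by all translations and the point group `D₄` (linear momentum `k` and the
`x`, `y`, `x-y` parities of Rodríguez-Guzmán et al. / Shi et al.).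
[cite: RodriguezGuzmanEtAl2012, §II eq. (6)] [cite: ShiEtAl2014, §II.A] -/
def squareSpaceGroup : Subgroup (Equiv.Perm (FermionTorus 2 L)) :=
  Subgroup.closure
    (Set.range (fun v : TorusSite 2 L => FermionTorus.ofTorusPerm (Equiv.addRight v)) ∪
      Set.range (fun γ : DihedralGroup 4 => FermionTorus.ofTorusPerm (L := L) (d4SitePerm γ)))

/-- The space group consists of graph automorphisms. [cite: ShiEtAl2014, §II.A] -/
theorem squareSpaceGroup_le_autPerm : squareSpaceGroup L ≤ autPerm (fermionTorusGraph 2 L) := by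
  refine (Subgroup.closure_le _).2 ?_
  rintro f (⟨v, rfl⟩ | ⟨γ, rfl⟩)
  exacts [ofTorusPerm_addRight_mem_autPerm v, ofTorusPerm_d4SitePerm_mem_autPerm γ]

/-- The space group of the finite torus is finite. [folklore] -/
noncomputable instance instFintypeSquareSpaceGroup : Fintype (squareSpaceGroup L) := Fintype.ofFinite _

/-- **The symmetry-projected (PHF) variational bound on the Hubbard torus `(ℤ/Lℤ)²`** with the
full space group (translations and `D₄`) and any of its unitary characters `χ` (momentum `k` +
parities), an abstract commuting Hermitian idempotent `Q` (spin-projector slot; `Q = 1` allowed)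
and any `N`-particle trial vector `Φ` with positive norm kernel:
`E₀((ℤ/Lℤ)², t, U; N) ≤ Re ⟨Φ, H Q P_χ Φ⟩ / Re ⟨Φ, Q P_χ Φ⟩` — stated for the rectangular
presentation `fermionRectTorusGraph L L` of the same torus (tree `groundEnergyAt_fermionTorusGraph_two`),
the form in which the cell's `E0Upper L L t U N q` rows are written.
[cite: RodriguezGuzmanEtAl2012, §II eqs. (5)–(8)] [cite: ShiEtAl2014, §II.A] -/
theorem rectTorus_groundEnergyAt_le_projected_div (t U : ℝ) (χ : squareSpaceGroup L →* Circle)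
    {Q : Matrix (Finset (Orb (FermionTorus 2 L))) (Finset (Orb (FermionTorus 2 L))) ℂ}
    (hQ : Qᴴ = Q) (hQQ : Q * Q = Q) (hQH : Commute Q (hubbardTorus 2 L t U))
    (hQρ : ∀ g : squareSpaceGroup L, Commute (latticeRep (squareSpaceGroup L).subtype g).val Q)
    {N : ℕ} (hQN : ∀ ψ : Fock (Orb (FermionTorus 2 L)), IsNParticle N ψ → IsNParticle N (Q *ᵥ ψ))
    {φ : Fock (Orb (FermionTorus 2 L))} (hφ : IsNParticle N φ)
    (hpos : 0 < (expect (Q * charProj (latticeRep (squareSpaceGroup L).subtype) χ) φ).re) :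
    groundEnergyAt (fermionRectTorusGraph L L) t U N ≤
      (expect (hubbardTorus 2 L t U * (Q * charProj (latticeRep (squareSpaceGroup L).subtype) χ)) φ).re /
        (expect (Q * charProj (latticeRep (squareSpaceGroup L).subtype) χ) φ).re := by
  rw [← groundEnergyAt_fermionTorusGraph_two]
  exact groundEnergyAt_le_projected_div_of_le_autPerm (fermionTorusGraph 2 L) squareSpaceGroup_le_autPerm
    t U χ hQ hQQ hQH hQρ hQN hφ hpos

end SquareTorus

/-! ### §5. The singlet projector `P_{S=0}` (orthogonal projection onto `ker S²`) as the spin slot `Q` -/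

section Singlet

variable {Λ : Type*} [LinearOrder Λ] [Fintype Λ]

/-- **The singlet projector** `P_{S=0}`: the orthogonal projection onto the kernel of the total-spin
Casimir `S² = (S^z)² + ½(S⁺S⁻ + S⁻S⁺)` on the fermionic Fock space (the `S = 0` subspace), as a
matrix (tree `projMatrix` of `ker S²`). This is the operator that the spin-projection integral
`P^{S=0} = (8π²)⁻¹ ∫ dΩ R̂(Ω)` of PHF represents; here it is DEFINED spectrally, the integral
representation is not formalised. [cite: RodriguezGuzmanEtAl2012, §II eq. (5)] -/
def singletProj : Matrix (Finset (Orb Λ)) (Finset (Orb Λ)) ℂ :=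
  projMatrix ((LinearMap.ker (Matrix.toLin' (spinSq : Matrix (Finset (Orb Λ)) (Finset (Orb Λ)) ℂ))).map
    ((WithLp.linearEquiv 2 ℂ (Finset (Orb Λ) → ℂ)).symm :
      (Finset (Orb Λ) → ℂ) →ₗ[ℂ] EuclideanSpace ℂ (Finset (Orb Λ))))

/-- `P_{S=0}` is Hermitian. [cite: RodriguezGuzmanEtAl2012, §II eq. (5)] -/
theorem singletProj_conjTranspose : (singletProj : Matrix (Finset (Orb Λ)) _ ℂ)ᴴ = singletProj :=
  (projMatrix_isHermitian _).eq

/-- `P_{S=0}` is idempotent. [cite: RodriguezGuzmanEtAl2012, §II eq. (5)] -/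
theorem singletProj_mul_self : (singletProj : Matrix (Finset (Orb Λ)) _ ℂ) * singletProj = singletProj :=
  projMatrix_mul_self _

/-- The range of `P_{S=0}` consists of singlets: `S² (P_{S=0} v) = 0`. [cite: RodriguezGuzmanEtAl2012, §II eq. (5)] -/
theorem spinSq_mulVec_singletProj_mulVec (v : Fock (Orb Λ)) :
    spinSq *ᵥ (singletProj *ᵥ v) = 0 := by
  have h := projMatrix_map_mulVec_mem (LinearMap.ker (Matrix.toLin' (spinSq : Matrix (Finset (Orb Λ)) _ ℂ))) v
  rwa [LinearMap.mem_ker, Matrix.toLin'_apply] at h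

/-- `P_{S=0}` fixes every singlet: `S² v = 0 → P_{S=0} v = v`. [cite: RodriguezGuzmanEtAl2012, §II eq. (5)] -/
theorem singletProj_mulVec_of_spinSq_mulVec_eq_zero {v : Fock (Orb Λ)} (hv : spinSq *ᵥ v = 0) :
    singletProj *ᵥ v = v :=
  projMatrix_map_mulVec_of_mem _ (by rwa [LinearMap.mem_ker, Matrix.toLin'_apply])

/-- An operator `B` such that both `B` and `Bᴴ` commute with `S²` commutes with `P_{S=0}`
(`B` and `Bᴴ` leave `ker S²` invariant; `B P = P B P` and its adjoint). [folklore] -/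
private theorem singletProj_commute_of_commute {B : Matrix (Finset (Orb Λ)) (Finset (Orb Λ)) ℂ}
    (hB : Commute B spinSq) (hB' : Commute Bᴴ spinSq) : Commute singletProj B := by
  set K := LinearMap.ker (Matrix.toLin' (spinSq : Matrix (Finset (Orb Λ)) _ ℂ)) with hK
  have hinv : ∀ (C : Matrix (Finset (Orb Λ)) (Finset (Orb Λ)) ℂ), Commute C spinSq → ∀ v ∈ K, C *ᵥ v ∈ K := by
    intro C hC v hv
    rw [hK, LinearMap.mem_ker, Matrix.toLin'_apply] at hv ⊢
    rw [mulVec_mulVec, ← hC.eq, ← mulVec_mulVec, hv, mulVec_zero]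
  have hPh : (singletProj : Matrix (Finset (Orb Λ)) _ ℂ)ᴴ = singletProj := singletProj_conjTranspose
  have h1 : ∀ (C : Matrix (Finset (Orb Λ)) (Finset (Orb Λ)) ℂ), Commute C spinSq →
      C * singletProj = singletProj * C * singletProj := by
    intro C hC
    refine Matrix.toLin'.injective (LinearMap.ext fun v => ?_)
    simp only [Matrix.toLin'_apply, ← mulVec_mulVec]
    exact (projMatrix_map_mulVec_of_mem K (hinv C hC _ (projMatrix_map_mulVec_mem K v))).symm
  have h2 : singletProj * B = singletProj * B * singletProj := by
    have h := congrArg conjTranspose (h1 Bᴴ hB')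
    rwa [conjTranspose_mul, conjTranspose_mul, conjTranspose_mul, conjTranspose_conjTranspose, hPh,
      ← Matrix.mul_assoc] at h
  change singletProj * B = B * singletProj
  rw [h2, ← h1 B hB]

/-- **`[S², H] = 0` for the Hubbard Hamiltonian on any graph** (`H` commutes with `S⁺`, `S⁻` and —
conserving `N↑, N↓` — with the diagonal `S^z`). Lieb, PRL 62 (1989) 1201 ("Of central importance
is the total spin `S` which is a conserved quantity"). [cite: LiebPRL1989, eq. (2)] -/
theorem spinSq_commute_hamiltonian (GΛ : SimpleGraph Λ) [DecidableRel GΛ.Adj] (t U : ℝ) :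
    Commute (spinSq : Matrix (Finset (Orb Λ)) _ ℂ) (hamiltonian GΛ t U) := by
  have hP : Commute (hamiltonian GΛ t U) (spinPlus : Matrix (Finset (Orb Λ)) _ ℂ) :=
    LiebThm1.hamiltonian_commute_spinPlus GΛ t U
  have hM : Commute (hamiltonian GΛ t U) (spinPlusᴴ : Matrix (Finset (Orb Λ)) _ ℂ) :=
    LiebThm1.hamiltonian_commute_spinMinus GΛ t U
  have hZ : Commute (hamiltonian GΛ t U) (HubbardWave0.spinZ : Matrix (Finset (Orb Λ)) _ ℂ) := by
    rw [LiebThm1.spinZ_eq_diagonal]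
    exact (LiebThm1.preservesSectors_hamiltonian GΛ t U).commute_diagonal
      fun a b => (1 / 2 : ℂ) * ((a : ℂ) - (b : ℂ))
  rw [spinSq]
  exact ((hZ.mul_right hZ).add_right
    (((hP.mul_right hM).add_right (hM.mul_right hP)).smul_right _)).symm

/-- `[S², N̂] = 0`. [folklore] -/
private theorem spinSq_commute_totalNumber :
    Commute (spinSq : Matrix (Finset (Orb Λ)) _ ℂ) totalNumber := by
  have hP : Commute (totalNumber : Matrix (Finset (Orb Λ)) _ ℂ) spinPlus := LiebTwo.totalNumber_mul_spinPlus
  have hM : Commute (totalNumber : Matrix (Finset (Orb Λ)) _ ℂ) spinPlusᴴ := LiebTwo.totalNumber_mul_spinMinus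
  have hZ : Commute (totalNumber : Matrix (Finset (Orb Λ)) _ ℂ) HubbardWave0.spinZ := LiebTwo.totalNumber_mul_spinZ
  rw [spinSq]
  exact ((hZ.mul_right hZ).add_right
    (((hP.mul_right hM).add_right (hM.mul_right hP)).smul_right _)).symm

/-- `P_{S=0}` commutes with the Hubbard Hamiltonian on any graph. [cite: RodriguezGuzmanEtAl2012, §II eq. (5)] -/
theorem singletProj_commute_hamiltonian (GΛ : SimpleGraph Λ) [DecidableRel GΛ.Adj] (t U : ℝ) :
    Commute (singletProj : Matrix (Finset (Orb Λ)) _ ℂ) (hamiltonian GΛ t U) := by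
  have hH : (hamiltonian GΛ t U)ᴴ = hamiltonian GΛ t U := (hamiltonian_isHermitian_and_commute_holds GΛ t U).1.eq
  exact singletProj_commute_of_commute (spinSq_commute_hamiltonian GΛ t U).symm
    (by rw [hH]; exact (spinSq_commute_hamiltonian GΛ t U).symm)

/-- `P_{S=0}` commutes with every orbital-permutation unitary of a site permutation (`S²` is
invariant under site relabellings, tree `relabel_mapEquiv_spinSq`) — spin and space-group
projectors commute, so `P^Θ = P^S · Ĉ(ξ)` is a projector. [cite: RodriguezGuzmanEtAl2012, §II eqs. (5)–(7)] -/
theorem fockRelabel_mapEquiv_commute_singletProj (f : Equiv.Perm Λ) :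
    Commute (fockRelabel (Orb.mapEquiv f)).val (singletProj : Matrix (Finset (Orb Λ)) _ ℂ) := by
  have h1 : ∀ g : Equiv.Perm Λ, Commute (fockRelabel (Orb.mapEquiv g)).val (spinSq : Matrix (Finset (Orb Λ)) _ ℂ) :=
    fun g => fockRelabel_commute_of_relabel_eq _ (relabel_mapEquiv_spinSq g)
  have h2 : ((fockRelabel (Orb.mapEquiv f)).val)ᴴ = (fockRelabel (Orb.mapEquiv f⁻¹)).val := by
    rw [← star_eq_conjTranspose, ← Matrix.UnitaryGroup.inv_val, ← map_inv]
    change (fockRelabel (Orb.mapPerm f)⁻¹).val = (fockRelabel (Orb.mapPerm f⁻¹)).val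
    rw [map_inv Orb.mapPerm]
  exact (singletProj_commute_of_commute (h1 f) (by rw [h2]; exact h1 f⁻¹)).symm

/-- `P_{S=0}` preserves every `N`-particle sector (it commutes with `N̂`, as do `S^z`, `S^±` of
Lieb's eq. (2)). [cite: LiebPRL1989, eq. (2)] -/
theorem isNParticle_singletProj_mulVec {N : ℕ} {ψ : Fock (Orb Λ)} (hψ : IsNParticle N ψ) :
    IsNParticle N (singletProj *ᵥ ψ) := by
  have hN : (totalNumber : Matrix (Finset (Orb Λ)) _ ℂ)ᴴ = totalNumber := by
    rw [LiebThm1.totalNumber_eq_diagonal, diagonal_conjTranspose]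
    congr 1; funext s; simp
  have hc : Commute (singletProj : Matrix (Finset (Orb Λ)) _ ℂ) totalNumber :=
    singletProj_commute_of_commute spinSq_commute_totalNumber.symm
      (by rw [hN]; exact spinSq_commute_totalNumber.symm)
  exact LiebTwo.isNParticle_mulVec_of_commute hψ hc.eq.symm

end Singlet

section SingletSquareTorus

open Literature.Probability.LatticeModels

variable {L : ℕ} [NeZero L]

/-- (Local DecidableEq pin, as in §4.) [folklore] -/
local instance (priority := high) instDecidableEqFermionTorusSymmetryProjectionSinglet :
    DecidableEq (FermionTorus 2 L) :=
  LinearOrder.toDecidableEq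

/-- **The spin- and space-group-projected (PHF) variational bound on the Hubbard torus `(ℤ/Lℤ)²`**
— Rodríguez-Guzmán et al. eq. (8) for `Θ = (S = 0; k, parities)`: for every unitary character
`χ` of the space group `squareSpaceGroup L` (translations and `D₄`) and every `N`-particle trial
vector `Φ` with positive norm kernel,
`E₀(L×L, t, U; N) ≤ Re ⟨Φ, H P_{S=0} P_χ Φ⟩ / Re ⟨Φ, P_{S=0} P_χ Φ⟩`,
with `P_{S=0} = singletProj` (the orthogonal projection onto `ker S²`) and `P_χ = charProj`. All
hypotheses on the spin projector of `rectTorus_groundEnergyAt_le_projected_div` are discharged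
here; what a certificate quoting this theorem must still supply is the arithmetic of the kernels
and its identification of the β-integral `½∫₀^π sin β R_y(β) dβ` with `P_{S=0}` on `S^z = 0`
vectors (RG2012 eq. (5); not formalised).
[cite: RodriguezGuzmanEtAl2012, §II eqs. (5)–(8)] [cite: ShiEtAl2014, §II.A] -/
theorem rectTorus_groundEnergyAt_le_singlet_projected_div (t U : ℝ) (χ : squareSpaceGroup L →* Circle)
    {N : ℕ} {φ : Fock (Orb (FermionTorus 2 L))} (hφ : IsNParticle N φ)
    (hpos : 0 < (expect (singletProj * charProj (latticeRep (squareSpaceGroup L).subtype) χ) φ).re) :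
    groundEnergyAt (fermionRectTorusGraph L L) t U N ≤
      (expect (hubbardTorus 2 L t U * (singletProj * charProj (latticeRep (squareSpaceGroup L).subtype) χ)) φ).re /
        (expect (singletProj * charProj (latticeRep (squareSpaceGroup L).subtype) χ) φ).re :=
  rectTorus_groundEnergyAt_le_projected_div t U χ singletProj_conjTranspose singletProj_mul_self
    (singletProj_commute_hamiltonian (fermionTorusGraph 2 L) t U)
    (fun g => fockRelabel_mapEquiv_commute_singletProj g.1) (fun _ h => isNParticle_singletProj_mulVec h)
    hφ hpos

end SingletSquareTorus

section HalfFilledSinglet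

/-- **The singlet projection loses nothing at half filling** (Lieb's theorem, as proved in the tree
for even rectangular tori): for `a, b` even, `t ≠ 0` and `U > 0`, every half-filled (`N = ab`)
ground-state eigenvector `φ` of the Hubbard Hamiltonian on `fermionRectTorusGraph a b` is a singlet
(`S² φ = 0`, `LiebHalfFilled.hubbardRectTorus_spinSq_mulVec_eq_zero_of_eigen`), hence
`P_{S=0} φ = φ`. [cite: LiebPRL1989, Theorem 2] -/
theorem singletProj_mulVec_halfFilled_groundState {a b : ℕ} [NeZero a] [NeZero b] (ha : Even a) (hb : Even b)
    {t U : ℝ} (ht : t ≠ 0) (hU : 0 < U) {φ : Fock (Orb (Fin a ×ₗ Fin b))} (hN : IsNParticle (a * b) φ)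
    (hHφ : hamiltonian (fermionRectTorusGraph a b) t U *ᵥ φ =
      ((groundEnergyAt (fermionRectTorusGraph a b) t U (a * b) : ℝ) : ℂ) • φ) :
    singletProj *ᵥ φ = φ :=
  singletProj_mulVec_of_spinSq_mulVec_eq_zero
    (LiebHalfFilled.hubbardRectTorus_spinSq_mulVec_eq_zero_of_eigen ha hb ht hU hN hHφ)

end HalfFilledSinglet

end SymmetryProjection

end Literature.MathematicalPhysics.QuantumLattice

end
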